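import Literature.MathematicalPhysics.QuantumLattice.PairFieldMomentum
import Literature.MathematicalPhysics.QuantumLattice.PairCorrelationsProofs
import Literature.Probability.LatticeModels.TorusFourierProofs
import Mathlib.Analysis.SpecialFunctions.Trigonometric.Bounds
import HarnessLib

/-!
# WeakCouplingBCS / crux `WcbcsSsbToTorusLRO` (stmt-HubbardSuperconductivity-2009), line
`tangent-face-legendre-spine` — the Fejér closure stub `stub_fejerClosure`

For a form factor `g`, a side `L`, a block scale `R > 0`, a window `η > 0` and a unit Fock vector
`ψ` on the fermionic torus `(ℤ/Lℤ)²`, write `P_x = localPair g L x`,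
`B_a = Σ_{u ∈ [0,R)²} P_{a+u}` (blocks wrap around the torus; no divisibility is needed),
`Δ_g(m) = pairFieldAt g L m = Σ_x conj χ_m(x) P_x` and `S(m) = pairStructureFactor g L ψ m =
‖Δ_g(m)ψ‖²/L²`. The stub proved here (`stub_fejerClosure`) is the finite Fourier inequality

`Σ_a ‖B_a ψ‖² /(R⁴L²) - Σ_{m ≠ 0, |q_m|² < η²} S(m) / L² - 2π² C_g² /(R² η²) ≤ Re⟨ψ, Δ_gᴴ Δ_g ψ⟩ / L⁴`,

`C_g = Σ_{e ∈ {0} ∪ unitSteps} 2|g e|/√2`, which closes block pair coherence and an infrared leak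
bound into zero-momentum pair long-range order. Ingredients (all elementary):

* block Plancherel (`sum_conjTranspose_mul_fourierMode` of `PairFieldMomentum`): the Fourier mode
  of the block family is `F(m) • Δ_g(m)` with the block kernel `F(m) = Σ_{u ∈ [0,R)²} χ_m(u)`, hence
  `Σ_a ‖B_a ψ‖² = Σ_m |F(m)|² S(m)`;
* kernel bounds: `|F(m)| ≤ R²`, `F(0) = R²`, and `|F(m)|² |q_m|² ≤ 2π² R²` (geometric sum in each
  coordinate, `|e^{iθ} - 1| = 2|sin(θ/2)|` and Jordan's inequality `|sin x| ≥ (2/π)|x|` on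
  `|x| ≤ π/2`, applied to the representative `valMinAbs` of least absolute value);
* the sum rule `Σ_m S(m) = Σ_x ‖P_x ψ‖² ≤ L² C_g²` (`sum_pairStructureFactor`,
  `norm_toLp_localPair_mulVec_le`) and `S(0) = Re⟨Δ_gᴴ Δ_g⟩/L²` (`pairStructureFactor_zero`).

Sources: Kennedy–Lieb–Shastry, PRL 61 (1988) 2582 (Fourier modes of an order operator and the
Parseval sum rule); Friedli–Velenik (2017) §10.4 (Fourier analysis on `(ℤ/Lℤ)^d`); the Fejér-kernel
estimate is textbook (Stein–Shakarchi, *Fourier Analysis*, Ch. 2–7). No definition is introduced;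
the helper lemmas are private.
-/

noncomputable section

set_option linter.dupNamespace false

namespace Summit.HubbardSuperconductivity.HubbardSuperconductivity.Theorems.WcbcsSsbToTorusLRO

open Literature.MathematicalPhysics.QuantumLattice Literature.Probability.LatticeModels Matrix Finset
open scoped ComplexConjugate ComplexOrder

/-! ### The one-dimensional kernel: a geometric character sum -/

section Kernel

variable {L : ℕ} [NeZero L]

/-- The character sum over an initial segment is a geometric sum:
`Σ_{v<R} e(k v) = Σ_{i<R} e(k)^i`. [folklore] -/
private theorem sum_stdAddChar_eq_geom_sum (k : ZMod L) (R : ℕ) :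
    ∑ v : Fin R, (ZMod.stdAddChar (k * ((v : ℕ) : ZMod L)) : ℂ) =
      ∑ i ∈ Finset.range R, (ZMod.stdAddChar k : ℂ) ^ i := by
  rw [Finset.sum_range]
  refine Finset.sum_congr rfl fun v _ => ?_
  rw [← AddChar.map_nsmul_eq_pow, nsmul_eq_mul, mul_comm]

/-- Trivial bound `|Σ_{v<R} e(k v)| ≤ R`. [folklore] -/
private theorem norm_sum_stdAddChar_le (k : ZMod L) (R : ℕ) :
    ‖∑ v : Fin R, (ZMod.stdAddChar (k * ((v : ℕ) : ZMod L)) : ℂ)‖ ≤ R := by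
  refine (norm_sum_le _ _).trans ?_
  simp

/-- For `|ω| = 1`: `|Σ_{i<R} ω^i| · |ω - 1| = |ω^R - 1| ≤ 2`. [folklore] -/
private theorem norm_geom_sum_mul_norm_sub_one_le (ω : ℂ) (hω : ‖ω‖ = 1) (R : ℕ) :
    ‖∑ i ∈ Finset.range R, ω ^ i‖ * ‖ω - 1‖ ≤ 2 := by
  rw [← norm_mul, geom_sum_mul]
  refine (norm_sub_le _ _).trans ?_
  rw [norm_pow, hω, one_pow, norm_one]
  norm_num

/-- Jordan's inequality in the form `4|n| ≤ L · |e^{2πi n/L} - 1|` for `|n| ≤ L/2`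
(`|e^{iθ} - 1| = 2|sin(θ/2)|`, `|sin x| ≥ (2/π)|x|` for `|x| ≤ π/2`). [folklore] -/
private theorem four_mul_abs_le_mul_norm_exp_sub_one (n : ℤ) (hn : |(n : ℝ)| ≤ L / 2) :
    4 * |(n : ℝ)| ≤ L * ‖Complex.exp (2 * Real.pi * Complex.I * n / L) - 1‖ := by
  have hL : (0 : ℝ) < L := Nat.cast_pos.2 (Nat.pos_of_ne_zero (NeZero.ne L))
  have h : (2 * Real.pi * Complex.I * n / L : ℂ) =
      Complex.I * ((2 * Real.pi * n / L : ℝ) : ℂ) := by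
    push_cast
    ring
  have hx' : (2 * Real.pi * n / L : ℝ) / 2 = Real.pi * (n / L) := by ring
  rw [h, Complex.norm_exp_I_mul_ofReal_sub_one, Real.norm_eq_abs, abs_mul, abs_two, hx']
  have hnL : |(n : ℝ) / L| ≤ 1 / 2 := by
    rw [abs_div, abs_of_pos hL, div_le_iff₀ hL]
    linarith
  have hx : |Real.pi * ((n : ℝ) / L)| ≤ Real.pi / 2 := by
    rw [abs_mul, abs_of_pos Real.pi_pos]
    calc Real.pi * |(n : ℝ) / L| ≤ Real.pi * (1 / 2) :=
          mul_le_mul_of_nonneg_left hnL Real.pi_pos.le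
      _ = Real.pi / 2 := by ring
  have hj := Real.mul_abs_le_abs_sin hx
  rw [abs_mul, abs_of_pos Real.pi_pos, abs_div, abs_of_pos hL] at hj
  have hj' : 2 / Real.pi * (Real.pi * (|(n : ℝ)| / L)) = 2 * |(n : ℝ)| / L := by
    field_simp
  rw [hj'] at hj
  have := mul_le_mul_of_nonneg_left hj hL.le
  rw [mul_div_cancel₀ _ hL.ne'] at this
  calc 4 * |(n : ℝ)| = 2 * (2 * |(n : ℝ)|) := by ring
    _ ≤ 2 * ((L : ℝ) * |Real.sin (Real.pi * (n / L))|) := by linarith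
    _ = L * (2 * |Real.sin (Real.pi * (n / L))|) := by ring

/-- **The one-dimensional Fejér-type kernel bound**: with `n = valMinAbs k ∈ (-L/2, L/2]`,
`|Σ_{v<R} e(k v)|² · (2π n/L)² ≤ π²` (geometric sum `≤ 2/|e(k) - 1|` and Jordan's inequality).
Stein–Shakarchi, *Fourier Analysis*, Ch. 2 (Fejér kernel). [folklore] -/
private theorem norm_sum_stdAddChar_sq_mul_le (k : ZMod L) (R : ℕ) :
    ‖∑ v : Fin R, (ZMod.stdAddChar (k * ((v : ℕ) : ZMod L)) : ℂ)‖ ^ 2 *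
        ((2 * Real.pi / L) ^ 2 * ((k.valMinAbs : ℤ) : ℝ) ^ 2) ≤ Real.pi ^ 2 := by
  have hL : (0 : ℝ) < L := Nat.cast_pos.2 (Nat.pos_of_ne_zero (NeZero.ne L))
  have hω : (ZMod.stdAddChar k : ℂ) =
      Complex.exp (2 * Real.pi * Complex.I * (k.valMinAbs : ℤ) / L) := by
    have h := ZMod.stdAddChar_coe (N := L) k.valMinAbs
    rwa [ZMod.coe_valMinAbs] at h
  have hn : |((k.valMinAbs : ℤ) : ℝ)| ≤ L / 2 := by
    have h := ZMod.valMinAbs_mem_Ioc k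
    rw [Set.mem_Ioc] at h
    have h1 : ((-(L : ℕ) : ℤ) : ℝ) < ((k.valMinAbs * 2 : ℤ) : ℝ) := by exact_mod_cast h.1
    have h2 : ((k.valMinAbs * 2 : ℤ) : ℝ) ≤ ((L : ℕ) : ℤ) := by exact_mod_cast h.2
    push_cast at h1 h2
    rw [abs_le]
    constructor <;> linarith
  have hnorm : ‖(ZMod.stdAddChar k : ℂ)‖ = 1 := by simp
  have h1 := norm_geom_sum_mul_norm_sub_one_le _ hnorm R
  rw [← sum_stdAddChar_eq_geom_sum] at h1
  have h2 := four_mul_abs_le_mul_norm_exp_sub_one (L := L) k.valMinAbs hn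
  rw [← hω] at h2
  set G := ∑ v : Fin R, (ZMod.stdAddChar (k * ((v : ℕ) : ZMod L)) : ℂ) with hG
  have h3 : ‖G‖ * (2 * |((k.valMinAbs : ℤ) : ℝ)|) ≤ L := by
    have := calc ‖G‖ * (4 * |((k.valMinAbs : ℤ) : ℝ)|)
          ≤ ‖G‖ * (L * ‖(ZMod.stdAddChar k : ℂ) - 1‖) :=
            mul_le_mul_of_nonneg_left h2 (norm_nonneg _)
      _ = L * (‖G‖ * ‖(ZMod.stdAddChar k : ℂ) - 1‖) := by ring
      _ ≤ L * 2 := mul_le_mul_of_nonneg_left h1 hL.le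
    linarith
  have h4 : (‖G‖ * (2 * |((k.valMinAbs : ℤ) : ℝ)|)) ^ 2 ≤ (L : ℝ) ^ 2 :=
    pow_le_pow_left₀ (by positivity) h3 2
  have h5 : ‖G‖ ^ 2 * ((2 * Real.pi / L) ^ 2 * ((k.valMinAbs : ℤ) : ℝ) ^ 2) =
      (‖G‖ * (2 * |((k.valMinAbs : ℤ) : ℝ)|)) ^ 2 * (Real.pi ^ 2 / (L : ℝ) ^ 2) := by
    rw [mul_pow, mul_pow, sq_abs]
    field_simp
  rw [h5]
  calc _ ≤ (L : ℝ) ^ 2 * (Real.pi ^ 2 / (L : ℝ) ^ 2) :=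
        mul_le_mul_of_nonneg_right h4 (by positivity)
    _ = Real.pi ^ 2 := by field_simp

/-! ### The block kernel `F(m) = Σ_{u ∈ [0,R)^d} χ_m(u)` -/

/-- The block kernel factorises over coordinates:
`Σ_{u ∈ [0,R)^d} χ_m(u) = Πᵢ Σ_{v<R} e(mᵢ v)`. [folklore] -/
private theorem blockKernel_eq_prod {d : ℕ} (m : TorusSite d L) (R : ℕ) :
    ∑ u : Fin d → Fin R, torusChar m (fun i => ((u i : ℕ) : ZMod L)) =
      ∏ i, ∑ v : Fin R, (ZMod.stdAddChar (m i * ((v : ℕ) : ZMod L)) : ℂ) := by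
  rw [Fintype.prod_sum]
  rfl

/-- `|F(m)| ≤ R^d`. [folklore] -/
private theorem norm_blockKernel_le {d : ℕ} (m : TorusSite d L) (R : ℕ) :
    ‖∑ u : Fin d → Fin R, torusChar m (fun i => ((u i : ℕ) : ZMod L))‖ ≤ (R : ℝ) ^ d := by
  refine (norm_sum_le _ _).trans ?_
  simp

/-- `F(0) = R^d`. [folklore] -/
private theorem blockKernel_zero {d : ℕ} (R : ℕ) :
    ∑ u : Fin d → Fin R, torusChar (0 : TorusSite d L) (fun i => ((u i : ℕ) : ZMod L)) =
      (R : ℂ) ^ d := by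
  simp

/-- **Off-window kernel bound** (`d = 2`): `|F(m)|² |q_m|² ≤ 2π² R²`, i.e.
`|F(m)|²/R⁴ ≤ 2π²/(R² |q_m|²)` — the one-dimensional bound in the coordinate carrying the momentum
and the trivial bound `≤ R` in the other. Stein–Shakarchi, *Fourier Analysis*, Ch. 2. [folklore] -/
private theorem norm_blockKernel_sq_mul_momentumNormSq_le (m : TorusSite 2 L) (R : ℕ) :
    ‖∑ u : Fin 2 → Fin R, torusChar m (fun i => ((u i : ℕ) : ZMod L))‖ ^ 2 * momentumNormSq L m ≤
      2 * Real.pi ^ 2 * (R : ℝ) ^ 2 := by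
  rw [blockKernel_eq_prod, norm_prod, Fin.prod_univ_two, momentumNormSq_apply, Fin.sum_univ_two]
  have h0 := norm_sum_stdAddChar_le (m 0) R
  have h1 := norm_sum_stdAddChar_le (m 1) R
  have k0 := norm_sum_stdAddChar_sq_mul_le (m 0) R
  have k1 := norm_sum_stdAddChar_sq_mul_le (m 1) R
  set G0 := ‖∑ v : Fin R, (ZMod.stdAddChar (m 0 * ((v : ℕ) : ZMod L)) : ℂ)‖
  set G1 := ‖∑ v : Fin R, (ZMod.stdAddChar (m 1 * ((v : ℕ) : ZMod L)) : ℂ)‖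
  have hG0 : G0 ^ 2 ≤ (R : ℝ) ^ 2 := pow_le_pow_left₀ (norm_nonneg _) h0 2
  have hG1 : G1 ^ 2 ≤ (R : ℝ) ^ 2 := pow_le_pow_left₀ (norm_nonneg _) h1 2
  calc (G0 * G1) ^ 2 * ((2 * Real.pi / L) ^ 2 *
          ((((m 0).valMinAbs : ℤ) : ℝ) ^ 2 + (((m 1).valMinAbs : ℤ) : ℝ) ^ 2))
        = G1 ^ 2 * (G0 ^ 2 * ((2 * Real.pi / L) ^ 2 * (((m 0).valMinAbs : ℤ) : ℝ) ^ 2)) +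
          G0 ^ 2 * (G1 ^ 2 * ((2 * Real.pi / L) ^ 2 * (((m 1).valMinAbs : ℤ) : ℝ) ^ 2)) := by
          ring
    _ ≤ (R : ℝ) ^ 2 * Real.pi ^ 2 + (R : ℝ) ^ 2 * Real.pi ^ 2 :=
          add_le_add (mul_le_mul hG1 k0 (by positivity) (by positivity))
            (mul_le_mul hG0 k1 (by positivity) (by positivity))
    _ = 2 * Real.pi ^ 2 * (R : ℝ) ^ 2 := by ring

end Kernel

/-! ### Block Plancherel -/

section Plancherel

variable {d L : ℕ} [NeZero L] {n : Type*} [Fintype n]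

/-- `z · conj z = |z|²` with `star` spelling and a real cast. [folklore] -/
private theorem mul_star_self_eq_ofReal (z : ℂ) : z * star z = ((‖z‖ ^ 2 : ℝ) : ℂ) := by
  rw [Complex.star_def, Complex.mul_conj']
  push_cast
  rfl

omit [Fintype n] in
/-- **Fourier mode of the block family.** For any family `P_x` of matrices on the torus and
`B_a = Σ_{u ∈ [0,R)^d} P_{a+u}`: `Σ_a conj χ_m(a) B_a = F(m) • Σ_y conj χ_m(y) P_y` with the block
kernel `F(m) = Σ_u χ_m(u)` (reindex `y = a + u`, `χ_m(y - u) = χ_m(y) conj χ_m(u)`).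
Friedli–Velenik (2017) §10.4. [folklore] -/
private theorem fourierMode_block (P : TorusSite d L → Matrix n n ℂ) (R : ℕ) (m : TorusSite d L) :
    ∑ a : TorusSite d L, conj (torusChar m a) •
        (∑ u : Fin d → Fin R, P (a + fun i => ((u i : ℕ) : ZMod L))) =
      (∑ u : Fin d → Fin R, torusChar m (fun i => ((u i : ℕ) : ZMod L))) •
        ∑ y : TorusSite d L, conj (torusChar m y) • P y := by
  rw [Finset.sum_smul]
  simp_rw [Finset.smul_sum]
  rw [Finset.sum_comm]
  refine Finset.sum_congr rfl fun u _ => ?_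
  refine Fintype.sum_equiv (Equiv.addRight (fun i => ((u i : ℕ) : ZMod L))) _ _ fun a => ?_
  simp only [Equiv.coe_addRight]
  rw [smul_smul, torusChar_add_right, map_mul, mul_left_comm, torusChar_mul_conj, mul_one]

/-- **Block Plancherel, vector form.** For any family `P_x`, blocks `B_a = Σ_{u ∈ [0,R)^d} P_{a+u}`,
modes `Δ(m) = Σ_y conj χ_m(y) P_y` and any vector `ψ`:
`L^d · Σ_a ‖B_a ψ‖² = Σ_m |F(m)|² ‖Δ(m) ψ‖²` (operator Plancherel
`sum_conjTranspose_mul_fourierMode` applied to the block family, whose Fourier mode is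
`F(m) • Δ(m)`). Kennedy–Lieb–Shastry, PRL 61 (1988) 2582 (Parseval sum rule). [folklore] -/
private theorem block_plancherel (P : TorusSite d L → Matrix n n ℂ) (R : ℕ) (ψ : n → ℂ) :
    (L : ℝ) ^ d * ∑ a : TorusSite d L,
        (star ((∑ u : Fin d → Fin R, P (a + fun i => ((u i : ℕ) : ZMod L))) *ᵥ ψ) ⬝ᵥ
          ((∑ u : Fin d → Fin R, P (a + fun i => ((u i : ℕ) : ZMod L))) *ᵥ ψ)).re =
      ∑ m : TorusSite d L,
        ‖∑ u : Fin d → Fin R, torusChar m (fun i => ((u i : ℕ) : ZMod L))‖ ^ 2 *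
          (star ((∑ y, conj (torusChar m y) • P y) *ᵥ ψ) ⬝ᵥ
            ((∑ y, conj (torusChar m y) • P y) *ᵥ ψ)).re := by
  have h := sum_conjTranspose_mul_fourierMode
    (fun a => ∑ u : Fin d → Fin R, P (a + fun i => ((u i : ℕ) : ZMod L)))
  simp only [fourierMode_block, conjTranspose_smul, Matrix.smul_mul, Matrix.mul_smul, smul_smul,
    mul_star_self_eq_ofReal] at h
  have h' := congrArg (fun T => (star ψ ⬝ᵥ (T *ᵥ ψ)).re) h
  simp only [sum_mulVec, dotProduct_sum, smul_mulVec, dotProduct_smul, smul_eq_mul,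
    Complex.re_sum, Complex.re_ofReal_mul] at h'
  have hc : ((L : ℂ) ^ d) = (((L : ℝ) ^ d : ℝ) : ℂ) := by push_cast; rfl
  rw [hc, Complex.re_ofReal_mul, Complex.re_sum] at h'
  simp_rw [star_mulVec_dotProduct_mulVec]
  exact h'.symm

end Plancherel

/-! ### The stub -/

/-- **Stub (F) of line `tangent-face-legendre-spine` — Fejér closure.** For every form factor `g`,
side `L`, block scale `R > 0`, window `η > 0` and unit vector `ψ`: block pair coherence per `R⁴L²`,
minus the punctured infrared pair weight per `L²`, minus the UV tail `2π² C_g²/(R² η²)`, is at most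
the zero-momentum pair order `Re⟨ψ, Δ_gᴴ Δ_g ψ⟩/L⁴`. Proof: `Σ_a ‖B_a ψ‖² = Σ_m |F(m)|² S(m)`
(`block_plancherel`, `pairFieldAt_eq_sum_torusChar`), then split the `m`-sum into `m = 0`
(`|F(0)|² = R⁴`, `S(0) = Re⟨Δ_gᴴΔ_g⟩/L²`), the punctured window (`|F|² ≤ R⁴`) and its complement
(`|F(m)|² ≤ 2π²R²/η²`, then the sum rule `Σ_m S(m) ≤ L² C_g²`).
Kennedy–Lieb–Shastry, PRL 61 (1988) 2582; Friedli–Velenik (2017) §10.4. [folklore] -/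
theorem stub_fejerClosure :
    ∀ (g : Site 2 → ℝ) (L : ℕ) [NeZero L] (R : ℕ), 0 < R → ∀ η : ℝ, 0 < η → ∀ ψ : Fock (Orb (FermionTorus 2 L)), star ψ ⬝ᵥ ψ = 1 → (∑ a : TorusSite 2 L, star ((∑ u : Fin 2 → Fin R, localPair g L (a + fun i => ((u i : ℕ) : ZMod L))) *ᵥ ψ) ⬝ᵥ ((∑ u : Fin 2 → Fin R, localPair g L (a + fun i => ((u i : ℕ) : ZMod L))) *ᵥ ψ)).re / ((R : ℝ) ^ 4 * (L : ℝ) ^ 2) - (∑ m ∈ (Finset.univ.filter fun m : TorusSite 2 L => m ≠ 0 ∧ momentumNormSq L m < η ^ 2), pairStructureFactor g L ψ m) / (L : ℝ) ^ 2 - 2 * Real.pi ^ 2 * (∑ e ∈ insert (0 : Site 2) unitSteps, ‖((g e / Real.sqrt 2 : ℝ) : ℂ)‖ * 2) ^ 2 / ((R : ℝ) ^ 2 * η ^ 2) ≤ (expect ((pairField g L)ᴴ * pairField g L) ψ).re / (L : ℝ) ^ 4 := by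
  intro g L _ R hR η hη ψ hψ
  have hRpos : (0 : ℝ) < R := Nat.cast_pos.2 hR
  have hLpos : (0 : ℝ) < L := Nat.cast_pos.2 (Nat.pos_of_ne_zero (NeZero.ne L))
  have hL2 : (L : ℝ) ^ 2 ≠ 0 := pow_ne_zero _ hLpos.ne'
  -- abbreviations
  set C : ℝ := ∑ e ∈ insert (0 : Site 2) unitSteps, ‖((g e / Real.sqrt 2 : ℝ) : ℂ)‖ * 2 with hC
  set S : TorusSite 2 L → ℝ := pairStructureFactor g L ψ with hS
  set W : Finset (TorusSite 2 L) :=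
    Finset.univ.filter fun m : TorusSite 2 L => m ≠ 0 ∧ momentumNormSq L m < η ^ 2 with hW
  set E : ℝ := (expect ((pairField g L)ᴴ * pairField g L) ψ).re with hE
  obtain ⟨F, hF⟩ : ∃ F : TorusSite 2 L → ℂ,
      ∀ m, F m = ∑ u : Fin 2 → Fin R, torusChar m (fun i => ((u i : ℕ) : ZMod L)) :=
    ⟨fun m => _, fun m => rfl⟩
  -- Step 1: the block Plancherel identity `Σ_a ‖B_a ψ‖² = Σ_m |F(m)|² S(m)`
  have hblock : (∑ a : TorusSite 2 L, star ((∑ u : Fin 2 → Fin R,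
      localPair g L (a + fun i => ((u i : ℕ) : ZMod L))) *ᵥ ψ) ⬝ᵥ ((∑ u : Fin 2 → Fin R,
      localPair g L (a + fun i => ((u i : ℕ) : ZMod L))) *ᵥ ψ)).re = ∑ m, ‖F m‖ ^ 2 * S m := by
    have h := block_plancherel (localPair g L) R ψ
    simp only [← pairFieldAt_eq_sum_torusChar, ← hF] at h
    have hSm : ∀ m, (star (pairFieldAt g L m *ᵥ ψ) ⬝ᵥ (pairFieldAt g L m *ᵥ ψ)).re =
        (L : ℝ) ^ 2 * S m := fun m => by
      rw [hS, pairStructureFactor_apply, mul_div_cancel₀ _ hL2]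
    simp only [hSm] at h
    rw [Complex.re_sum]
    refine mul_left_cancel₀ hL2 ?_
    rw [h, Finset.mul_sum]
    exact Finset.sum_congr rfl fun m _ => by ring
  -- Step 2: kernel bounds
  have hF0 : ‖F 0‖ ^ 2 = (R : ℝ) ^ 4 := by
    rw [hF, blockKernel_zero, norm_pow, Complex.norm_natCast]
    ring
  have hFle : ∀ m, ‖F m‖ ^ 2 ≤ (R : ℝ) ^ 4 := fun m => by
    rw [hF, show (R : ℝ) ^ 4 = ((R : ℝ) ^ 2) ^ 2 by ring]
    exact pow_le_pow_left₀ (norm_nonneg _) (norm_blockKernel_le m R) 2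
  have hFoff : ∀ m, η ^ 2 ≤ momentumNormSq L m →
      ‖F m‖ ^ 2 ≤ 2 * Real.pi ^ 2 * (R : ℝ) ^ 2 / η ^ 2 := fun m hm => by
    rw [le_div_iff₀ (by positivity), hF]
    exact (mul_le_mul_of_nonneg_left hm (sq_nonneg _)).trans
      (norm_blockKernel_sq_mul_momentumNormSq_le m R)
  have hSnn : ∀ m, 0 ≤ S m := fun m => pairStructureFactor_nonneg g L ψ m
  -- the sum rule `Σ_m S(m) = Σ_x ‖P_x ψ‖² ≤ L² C²`
  have hsum : ∑ m, S m ≤ (L : ℝ) ^ 2 * C ^ 2 := by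
    rw [hS, sum_pairStructureFactor]
    have hψ1 : ‖(WithLp.toLp 2 ψ : EuclideanSpace ℂ (Finset (Orb (FermionTorus 2 L))))‖ = 1 := by
      have h := norm_toLp_sq_eq_re ψ
      rw [hψ, Complex.one_re] at h
      exact (pow_eq_one_iff_of_nonneg (norm_nonneg _) two_ne_zero).1 h
    have hx : ∀ x : TorusSite 2 L,
        (star (localPair g L x *ᵥ ψ) ⬝ᵥ (localPair g L x *ᵥ ψ)).re ≤ C ^ 2 := fun x => by
      rw [← norm_toLp_sq_eq_re]
      have h := norm_toLp_localPair_mulVec_le g L x ψ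
      rw [hψ1, mul_one] at h
      exact pow_le_pow_left₀ (norm_nonneg _) h 2
    refine (Finset.sum_le_sum fun x _ => hx x).trans (le_of_eq ?_)
    simp only [Finset.sum_const, Finset.card_univ, Fintype.card_pi, ZMod.card, Finset.prod_const,
      Fintype.card_fin, nsmul_eq_mul]
    push_cast
    ring
  -- Step 3: pointwise splitting of `|F(m)|² S(m)`
  have hpt : ∀ m ∈ (Finset.univ : Finset (TorusSite 2 L)), ‖F m‖ ^ 2 * S m ≤
      (if m = 0 then (R : ℝ) ^ 4 * S m else 0) + (if m ∈ W then (R : ℝ) ^ 4 * S m else 0) +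
        2 * Real.pi ^ 2 * (R : ℝ) ^ 2 / η ^ 2 * S m := by
    intro m _
    have hc : 0 ≤ 2 * Real.pi ^ 2 * (R : ℝ) ^ 2 / η ^ 2 * S m := mul_nonneg (by positivity) (hSnn m)
    by_cases hm : m = 0
    · subst hm
      have hW0 : (0 : TorusSite 2 L) ∉ W := by simp [hW]
      rw [if_pos rfl, if_neg hW0, hF0]
      linarith
    · rw [if_neg hm]
      by_cases hq : momentumNormSq L m < η ^ 2
      · have hmW : m ∈ W := by simp [hW, hm, hq]
        rw [if_pos hmW]
        have := mul_le_mul_of_nonneg_right (hFle m) (hSnn m)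
        linarith
      · have hmW : m ∉ W := by simp [hW, hq]
        rw [if_neg hmW]
        have := mul_le_mul_of_nonneg_right (hFoff m (not_lt.1 hq)) (hSnn m)
        linarith
  have hest : ∑ m, ‖F m‖ ^ 2 * S m ≤ (R : ℝ) ^ 4 * S 0 + (R : ℝ) ^ 4 * ∑ m ∈ W, S m +
      2 * Real.pi ^ 2 * (R : ℝ) ^ 2 / η ^ 2 * ∑ m, S m := by
    refine (Finset.sum_le_sum hpt).trans (le_of_eq ?_)
    rw [Finset.sum_add_distrib, Finset.sum_add_distrib, Fintype.sum_ite_eq', Fintype.sum_ite_mem,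
      ← Finset.mul_sum, ← Finset.mul_sum]
  -- Step 4: assemble
  have hS0 : S 0 = E / (L : ℝ) ^ 2 := pairStructureFactor_zero g L ψ
  have key : (∑ a : TorusSite 2 L, star ((∑ u : Fin 2 → Fin R,
      localPair g L (a + fun i => ((u i : ℕ) : ZMod L))) *ᵥ ψ) ⬝ᵥ ((∑ u : Fin 2 → Fin R,
      localPair g L (a + fun i => ((u i : ℕ) : ZMod L))) *ᵥ ψ)).re ≤
      (R : ℝ) ^ 4 * (E / (L : ℝ) ^ 2) + (R : ℝ) ^ 4 * ∑ m ∈ W, S m +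
        2 * Real.pi ^ 2 * (R : ℝ) ^ 2 / η ^ 2 * ((L : ℝ) ^ 2 * C ^ 2) := by
    rw [hblock, ← hS0]
    refine hest.trans ?_
    have := mul_le_mul_of_nonneg_left hsum
      (show (0 : ℝ) ≤ 2 * Real.pi ^ 2 * (R : ℝ) ^ 2 / η ^ 2 by positivity)
    linarith
  have h1 := div_le_div_of_nonneg_right key
    (show (0 : ℝ) ≤ (R : ℝ) ^ 4 * (L : ℝ) ^ 2 by positivity)
  have h2 : ((R : ℝ) ^ 4 * (E / (L : ℝ) ^ 2) + (R : ℝ) ^ 4 * ∑ m ∈ W, S m +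
        2 * Real.pi ^ 2 * (R : ℝ) ^ 2 / η ^ 2 * ((L : ℝ) ^ 2 * C ^ 2)) / ((R : ℝ) ^ 4 * (L : ℝ) ^ 2) =
      E / (L : ℝ) ^ 4 + (∑ m ∈ W, S m) / (L : ℝ) ^ 2 +
        2 * Real.pi ^ 2 * C ^ 2 / ((R : ℝ) ^ 2 * η ^ 2) := by
    field_simp
  rw [h2] at h1
  linarith

end Summit.HubbardSuperconductivity.HubbardSuperconductivity.Theorems.WcbcsSsbToTorusLRO
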